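import Literature.NumberTheory.Rogawski1990.ArchChartBoxCoherence                 -- ★ R3 (LH1-p02): `exists_forall_conj_endoEmbArch_endoTorus_eq_gprimeTorus`, `mem_preimage_subgroupCongr_symm_chartBoxImgG_iff`; brings `chartTorusG ∕ chartBoxImgG`
import Literature.NumberTheory.Rogawski1990.ArchInnerTwistChartDictionary           -- ★ (3) DICTIONARY (LH7-p04 (g8)) p851905: `mem_splitChartPlaces_quasiSplitWeights` (+ the congruence binders `(T) (Φ) (hΦ)` convention)
import Literature.NumberTheory.Automorphic.ArchCongruenceOrbitalTransport          -- ★ (T-d) FILE 1: `forall_archCongr_mem_centralizer_iff`, `formCongr_quasiSplitFrame_diagonal`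
import Literature.NumberTheory.Automorphic.ArchInnerFormCartanAtlasRegular          -- ★ `isRegularElt_gprimeTorus_iff_mem_regG`
import Literature.MeasureTheory.Group.InvariantQuotientTransport                   -- ★ `subgroupCongrHomeomorph`, `coe_subgroupCongrHomeomorph_apply`
import HarnessLib

/-!
# Box coherence ACROSS THE INNER TWIST: the `G′`- and `G`-frame masses of the chart box agree at partner chart points ((C′G) read on the Cartan atlas; N8-INNER brick (4)
# READ-G, FILE B; Rogawski 1990 §1.7, §4.3 (4.3.1), §14.1–14.2; Shelstad 1979 §4 p. 20)

Topic `NumberTheory/Rogawski1990`; namespaces `Literature.NumberTheory.Automorphic.UnitaryGroup` (§1) and `Literature.NumberTheory.Rogawski1990` (§2–§4).  THEOREMS ONLY (no `def`, no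
instance, no notation, no axiom, no named fact, no `sorry`).  Cell `pub/hodgecm-mathlib`, crux H413 (`stmt-HodgeConjecture-24833`), F0∕P3c road «N8-INNER» (LEAD T14-4; row 2 `stub_N8`,
archimedean INNER transfer `G′_∞ → G_∞`), brick (4) «READ-G» of the N8-ROAD-CENSUS v0 fd90e2d340c810dd §2 row «READ» («(C′G): the transported centraliser measures make the `G′` and `G`
box masses EQUAL at partners — the content of Shelstad's normalisation §4 p. 20»); LH2-plan (g1) DEAL #1 2026-09-02T15:34:48Z, holder LH7-p01 (g7); ref5 R-725 «FILE B §1–§3 ✓»; SIGSHEET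
`F0/P3c/LH7/LH7-p01/g7/SIGSHEET-N8-brick4-ReadG.v1.LH7p01g7.md` d6e741fda879bbc7.  Sequel of ★ READ-G′ `ArchStableSideChartReadG` (parts I∕II).  Count-neutral.

THE SETTING (currency defaults (D1) of the road: the `G`-atlas is the `G′`-atlas at a second house frame `β`, read on the closer's carrier `U(H₂)(L⁺ ⊗ ℝ)` — `H₂ = Φ₃` for (14.2.1) — through
a congruence `Φ : U(H₂)(L⁺ ⊗ ℝ) ≃ₜ* U(diag β)(L⁺ ⊗ ℝ)`, `Φ g = T g T⁻¹`, the ABSTRACT binders `(T) (Φ) (hΦ)` of ★ (3) `ArchInnerTwistChartDictionary` §4; for `β = β₀ = (½, 1, −½)` the tree's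
term is `Ψ_Q` over ★ `formCongr_quasiSplitFrame_diagonal`).  Two house frames `α`, `β` (`α_i, β_i ≠ 0`, real at every complex place), a common admissible chart `S` (`S ⊆ splitChartPlaces L α`
and `⊆ splitChartPlaces L β`), `c ∈ RegG S`; `γ′ = gprimeTorus α S c ∈ G′_∞` (regular, `Z(γ′) = T^α_S`) and its partner `γ = Φ⁻¹(gprimeTorus β S c) ∈ U(H₂)(L⁺ ⊗ ℝ)` (★ (3)
`corresponds_gprimeTorus_archCongr_symm_gprimeTorus`: same eigenvalue data place by place).
* §1 **ONE ambient conjugator for the whole chart**: `y ∈ GL₃(L ⊗ ℝ)` with `y · gprimeTorus α S c₀ · y⁻¹ = gprimeTorus β S c₀` for EVERY `c₀` (compose the two ★ R3 conjugators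
  `ι_∞(endoTorus S c₀) ↦ gprimeTorus α S c₀`, `↦ gprimeTorus β S c₀` through the common `H`-chart — no matrix computation), hence `y′ = T⁻¹ y` with
  `y′ · gprimeTorus α S c₀ · y′⁻¹ = Φ⁻¹(gprimeTorus β S c₀)`.
* §2 **THE (C′G) TRANSPORT ON CHART POINTS IS THE IDENTITY ON COORDINATES**: the stable centraliser transport `e : Z_{G′}(γ′) ≃ₜ* Z_{U(H₂)}(γ)` (★ `archStableCentralizerEquiv`, canonical:
  two stable conjugators differ by the commutative `Z(γ′)`) sends `z` with `↑z = gprimeTorus α S c₀` to `Φ⁻¹(gprimeTorus β S c₀)` (★ `coe_archStableCentralizerEquiv_eq_of_conj_eq` with §1's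
  `y′`), and `Φ|_Z ∘ e` lands on `gprimeTorus β S c₀ ∈ Z(gprimeTorus β S c) = T^β_S`; it carries the `α`-box `{z | ↑z ∈ gprimeTorus α S '' chartBox S}` ONTO the `β`-box.
* §3 **THE TWO JUNCTION SCALARS COINCIDE** — in one frame with (C′G) across `G′_∞ ↔ U(H₂)(L⁺ ⊗ ℝ)` (`hC′G`, the clause of ★ `ArchCompatibleFamiliesG` VERBATIM in shape, `H₂` for the
  literal `Φ₃`) and the torus datum `t_β` on `U(diag β)(L⁺ ⊗ ℝ)` PUSHED from `t` along `Φ` (`ht_β`, the shape of ★ `ArchWeilDataCongruence` ∕ `torusPush_archCongr_apply`, as the payer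
  brick (11) instantiates ★ READ-G′ part II at `α := β` on the pushed frame ★ `isQuotientOf_transport_archCongr`):
  **`toReal_map_t'_chartBoxImgG_eq_toReal_map_torusPush_chartBoxImgG`** — `M′_{t′}(gprimeTorus α S c) = M_{t_β}(gprimeTorus β S c)`, i.e. the `M′(c)` of ★
  `stableOrbitalIntegralRel_gprimeTorus_mul_boxMass_eq_sum` at `α` EQUALS its `M′(c)` at `β` on the pushed frame (`t_β(γ_β) = (Φ|_Z ∘ e)_* t′(γ′)` by (C′G) + the push; §2;
  injectivity of `Φ|_Z ∘ e`).  With ★ READ-G′ part II on both sides and ★ `archStableOrbitalIntegral_transport_archCongr`, branch (i) of (14.2.1) at chart points reads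
  «`Φ^st_m(γ, a) = Φ^st_{m′}(γ′, a′)` iff the two slot sums of `chartOrbG` agree» — the FORWARD∕junction bricks' seam.
* §4 the instance `β := β₀ = quasiSplitWeights` (every complex place a split-chart place, ★ `mem_splitChartPlaces_quasiSplitWeights`): **`…_quasiSplit`**, chart set `S ⊆ splitChartPlaces L α` only.
HONEST LABEL: HC_CM is proved only modulo the 7 printed citations (2 remaining: hLiu418 = `stmt-HodgeConjecture-24832`, h413 = `stmt-HodgeConjecture-24833`) until rung 0 closes;
count-neutral until (Sh)′ is ★ and ED. 43 re-keys 27456 6 → 5.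

## References
* [Rogawski1990] J. D. Rogawski, *Automorphic Representations of Unitary Groups in Three Variables*, Ann. of Math. Stud. 123 (1990), §1.7 p. 6 («compatible measures»), §4.3 (4.3.1)
  pp. 43–44 (measures on the tori of a stable class transported along stable conjugacy), §14.1 p. 232 (the inner twist `ψ`, `γ′ ↔ γ`), §14.2 (14.2.1) p. 232, §8.2 p. 122.
* [Shelstad1979] D. Shelstad, *Characters and inner forms of a quasi-split group over ℝ*, Compositio Math. 39 (1979), §4 p. 20 («the pair `dt′, ψ_x` defines a measure `dt` on `T`,
  independently of the choice of `x` and consistently with the choice of `dg`»), Lemma 4.2 p. 23.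
* [LanglandsShelstad1987] R. P. Langlands, D. Shelstad, *On the definition of transfer factors*, Math. Ann. 278 (1987), §1.3–1.4.
* [PlatonovRapinchuk1994] V. Platonov, A. Rapinchuk, *Algebraic Groups and Number Theory* (1994), §2.3 (equivalent hermitian forms have conjugate unitary groups).
-/

set_option autoImplicit false

noncomputable section

open MeasureTheory MeasureTheory.Measure NumberField NumberField.InfinitePlace Matrix Complex Topology
open Literature.MeasureTheory.Group
open scoped MatrixGroups Matrix Classical NNReal ENNReal

/-! ## §1 One element of `GL₃(L ⊗ ℝ)` conjugates the whole `α`-chart onto the whole `β`-chart (and onto its `Φ⁻¹`-image) -/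

namespace Literature.NumberTheory.Automorphic.UnitaryGroup

open Literature.NumberTheory.Rogawski1990 Literature.NumberTheory.Automorphic.ArchCartan

section Global

variable (L : Type) [Field L] [NumberField L] [IsCMField L] (α β : Fin 3 → L) (S : Finset {w : InfinitePlace L // IsComplex w})

/-- **SIMULTANEOUS CONJUGATION BETWEEN TWO HOUSE FRAMES**: for a chart set `S` admissible for both `α` and `β` there is ONE `y ∈ GL₃(L ⊗ ℝ)` with
`y · gprimeTorus α S c · y⁻¹ = gprimeTorus β S c` for EVERY `c` — compose the two ★ R3 conjugators from the common `H`-chart point `ι_∞(endoTorus S c)`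
(★ `exists_forall_conj_endoEmbArch_endoTorus_eq_gprimeTorus` at `ρ = 1`). [cite: Rogawski1990, §14.1 p. 232; §4.3 pp. 43–44; §3.6 p. 31] [cite: Shelstad1979, §4 p. 22] -/
theorem exists_forall_conj_gprimeTorus_eq_gprimeTorus (hSα : ∀ w ∈ S, w ∈ splitChartPlaces L α) (hSβ : ∀ w ∈ S, w ∈ splitChartPlaces L β) :
    ∃ y : GL (Fin 3) (mixedEmbedding.mixedSpace L), ∀ c : {w : InfinitePlace L // IsComplex w} → Fin 3 → ℝ,
      y * ((gprimeTorus L α S c).val : GL (Fin 3) (mixedEmbedding.mixedSpace L)) * y⁻¹ = ((gprimeTorus L β S c).val : GL (Fin 3) (mixedEmbedding.mixedSpace L)) := by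
  obtain ⟨yα, hyα⟩ := exists_forall_conj_endoEmbArch_endoTorus_eq_gprimeTorus L α S hSα 1 (fun _ _ => rfl)
  obtain ⟨yβ, hyβ⟩ := exists_forall_conj_endoEmbArch_endoTorus_eq_gprimeTorus L β S hSβ 1 (fun _ _ => rfl)
  refine ⟨yβ * yα⁻¹, fun c => ?_⟩
  have hα := hyα c
  have hβ := hyβ c
  rw [slotPerm_one] at hα hβ
  -- `yα⁻¹ · gprimeTorus α S c · yα = ι_∞(endoTorus S c)`
  have hα' : yα⁻¹ * ((gprimeTorus L α S c).val : GL (Fin 3) (mixedEmbedding.mixedSpace L)) * yα =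
      ((endoEmbArch L (endoTorus L S c)).val : GL (Fin 3) (mixedEmbedding.mixedSpace L)) := by
    rw [← hα]; group
  calc yβ * yα⁻¹ * ((gprimeTorus L α S c).val : GL (Fin 3) (mixedEmbedding.mixedSpace L)) * (yβ * yα⁻¹)⁻¹
      = yβ * (yα⁻¹ * ((gprimeTorus L α S c).val : GL (Fin 3) (mixedEmbedding.mixedSpace L)) * yα) * yβ⁻¹ := by group
    _ = ((gprimeTorus L β S c).val : GL (Fin 3) (mixedEmbedding.mixedSpace L)) := by rw [hα', hβ]

variable {H₂ : Matrix (Fin 3) (Fin 3) L} (T : GL (Fin 3) (mixedEmbedding.mixedSpace L))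
  (Φ : arch (↥(maximalRealSubfield L)) L (IsCMField.complexConj L) 3 H₂ ≃ₜ* arch (↥(maximalRealSubfield L)) L (IsCMField.complexConj L) 3 (Matrix.diagonal β))
  (hΦ : ∀ g : arch (↥(maximalRealSubfield L)) L (IsCMField.complexConj L) 3 H₂,
    ((Φ g : arch (↥(maximalRealSubfield L)) L (IsCMField.complexConj L) 3 (Matrix.diagonal β)) : GL (Fin 3) (mixedEmbedding.mixedSpace L)) =
      T * (g : GL (Fin 3) (mixedEmbedding.mixedSpace L)) * T⁻¹)

include hΦ in
/-- Reading `Φ⁻¹` in the ambient group: `↑(Φ⁻¹ x) = T⁻¹ · ↑x · T`. [cite: PlatonovRapinchuk1994, §2.3] -/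
theorem coe_archCongr_symm_eq (x : arch (↥(maximalRealSubfield L)) L (IsCMField.complexConj L) 3 (Matrix.diagonal β)) :
    ((Φ.symm x : arch (↥(maximalRealSubfield L)) L (IsCMField.complexConj L) 3 H₂) : GL (Fin 3) (mixedEmbedding.mixedSpace L)) =
      T⁻¹ * (x : GL (Fin 3) (mixedEmbedding.mixedSpace L)) * T := by
  have h := hΦ (Φ.symm x)
  rw [ContinuousMulEquiv.apply_symm_apply] at h
  rw [h]; group

include hΦ in
/-- **SIMULTANEOUS CONJUGATION ONTO THE `Φ⁻¹`-IMAGE OF THE `β`-CHART**: ONE `y′ ∈ GL₃(L ⊗ ℝ)` (`= T⁻¹ y`) with `y′ · gprimeTorus α S c · y′⁻¹ = Φ⁻¹(gprimeTorus β S c)` in `U(H₂)(L⁺ ⊗ ℝ)` for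
EVERY `c` — the coordinate-free conjugator realising the partner correspondence ★ `corresponds_gprimeTorus_archCongr_symm_gprimeTorus` uniformly on the chart.
[cite: Rogawski1990, §14.1 p. 232; §14.2 (14.2.1) p. 232] [cite: Shelstad1979, §4 p. 20] [cite: PlatonovRapinchuk1994, §2.3] -/
theorem exists_forall_conj_gprimeTorus_eq_archCongr_symm_gprimeTorus (hSα : ∀ w ∈ S, w ∈ splitChartPlaces L α) (hSβ : ∀ w ∈ S, w ∈ splitChartPlaces L β) :
    ∃ y : GL (Fin 3) (mixedEmbedding.mixedSpace L), ∀ c : {w : InfinitePlace L // IsComplex w} → Fin 3 → ℝ,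
      y * ((gprimeTorus L α S c).val : GL (Fin 3) (mixedEmbedding.mixedSpace L)) * y⁻¹ =
        ((Φ.symm (gprimeTorus L β S c) : arch (↥(maximalRealSubfield L)) L (IsCMField.complexConj L) 3 H₂).val : GL (Fin 3) (mixedEmbedding.mixedSpace L)) := by
  obtain ⟨y, hy⟩ := exists_forall_conj_gprimeTorus_eq_gprimeTorus L α β S hSα hSβ
  refine ⟨T⁻¹ * y, fun c => ?_⟩
  have h := coe_archCongr_symm_eq L β T Φ hΦ (gprimeTorus L β S c)
  have h' : ((Φ.symm (gprimeTorus L β S c) : arch (↥(maximalRealSubfield L)) L (IsCMField.complexConj L) 3 H₂).val : GL (Fin 3) (mixedEmbedding.mixedSpace L)) =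
      T⁻¹ * ((gprimeTorus L β S c).val : GL (Fin 3) (mixedEmbedding.mixedSpace L)) * T := h
  rw [h', ← hy c]; group

include hΦ in
/-- **The partner correspondence on the chart** (a second proof of ★ (3) `corresponds_gprimeTorus_archCongr_symm_gprimeTorus`, through §1's uniform conjugator).
[cite: Rogawski1990, §14.1 p. 232] -/
theorem corresponds_gprimeTorus_archCongr_symm_gprimeTorus' (hSα : ∀ w ∈ S, w ∈ splitChartPlaces L α) (hSβ : ∀ w ∈ S, w ∈ splitChartPlaces L β)
    (c : {w : InfinitePlace L // IsComplex w} → Fin 3 → ℝ) :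
    Corresponds (conjMixed (↥(maximalRealSubfield L)) L (IsCMField.complexConj L)) (archFormOf L 3 (Matrix.diagonal α)) (archFormOf L 3 H₂)
      (gprimeTorus L α S c) (Φ.symm (gprimeTorus L β S c)) := by
  obtain ⟨y, hy⟩ := exists_forall_conj_gprimeTorus_eq_archCongr_symm_gprimeTorus L α β S T Φ hΦ hSα hSβ
  exact isConj_iff.2 ⟨y, hy c⟩

end Global

end Literature.NumberTheory.Automorphic.UnitaryGroup

/-! ## §2 The (C′G) transport on chart points is the identity on coordinates -/

namespace Literature.NumberTheory.Rogawski1990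

open Literature.NumberTheory.Automorphic Literature.NumberTheory.Automorphic.UnitaryGroup Literature.NumberTheory.Automorphic.ArchCartan

section Transport

variable (L : Type) [Field L] [NumberField L] [IsCMField L] (α β : Fin 3 → L) (S : Finset {w : InfinitePlace L // IsComplex w})
  {H₂ : Matrix (Fin 3) (Fin 3) L} (hdα : (Matrix.diagonal α).det ≠ 0) (hd₂ : H₂.det ≠ 0)
  (T : GL (Fin 3) (mixedEmbedding.mixedSpace L))
  (Φ : arch (↥(maximalRealSubfield L)) L (IsCMField.complexConj L) 3 H₂ ≃ₜ* arch (↥(maximalRealSubfield L)) L (IsCMField.complexConj L) 3 (Matrix.diagonal β))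
  (hΦ : ∀ g : arch (↥(maximalRealSubfield L)) L (IsCMField.complexConj L) 3 H₂,
    ((Φ g : arch (↥(maximalRealSubfield L)) L (IsCMField.complexConj L) 3 (Matrix.diagonal β)) : GL (Fin 3) (mixedEmbedding.mixedSpace L)) =
      T * (g : GL (Fin 3) (mixedEmbedding.mixedSpace L)) * T⁻¹)
  (hSα : ∀ w ∈ S, w ∈ splitChartPlaces L α) (hSβ : ∀ w ∈ S, w ∈ splitChartPlaces L β)
  {c : {w : InfinitePlace L // IsComplex w} → Fin 3 → ℝ} (hc : c ∈ ArchCartan.RegG S)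

include hΦ hSα hSβ in
/-- **THE (C′G) TRANSPORT ON CHART POINTS**: for the regular chart point `γ′ = gprimeTorus α S c` and its partner `γ = Φ⁻¹(gprimeTorus β S c)`, the stable centraliser transport
`e : Z_{G′}(γ′) ≃ₜ* Z_{U(H₂)}(γ)` sends `z` with `↑z = gprimeTorus α S c₀` to `Φ⁻¹(gprimeTorus β S c₀)` — for EVERY `c₀` (★ `coe_archStableCentralizerEquiv_eq_of_conj_eq` with §1's conjugator;
«the pair `dt′, ψ_x` defines `dt` independently of `x`»). [cite: Rogawski1990, §4.3 pp. 43–44; §14.1 p. 232] [cite: Shelstad1979, §4 p. 20] [cite: LanglandsShelstad1987, §1.3–1.4] -/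
theorem coe_archStableCentralizerEquiv_gprimeTorus_archCongr_symm_of_coe_eq
    (hcorr : Corresponds (conjMixed (↥(maximalRealSubfield L)) L (IsCMField.complexConj L)) (archFormOf L 3 (Matrix.diagonal α)) (archFormOf L 3 H₂)
      (gprimeTorus L α S c) (Φ.symm (gprimeTorus L β S c)))
    (hreg : IsRegularElt ((gprimeTorus L α S c).val : GL (Fin 3) (mixedEmbedding.mixedSpace L)))
    (z : Subgroup.centralizer ({gprimeTorus L α S c} : Set ↥(arch (↥(maximalRealSubfield L)) L (IsCMField.complexConj L) 3 (Matrix.diagonal α))))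
    {c₀ : {w : InfinitePlace L // IsComplex w} → Fin 3 → ℝ}
    (hz : (z : ↥(arch (↥(maximalRealSubfield L)) L (IsCMField.complexConj L) 3 (Matrix.diagonal α))) = gprimeTorus L α S c₀) :
    ((archStableCentralizerEquiv L hdα hd₂ hcorr hreg z : Subgroup.centralizer ({Φ.symm (gprimeTorus L β S c)} : Set ↥(arch (↥(maximalRealSubfield L)) L (IsCMField.complexConj L) 3 H₂))) :
        ↥(arch (↥(maximalRealSubfield L)) L (IsCMField.complexConj L) 3 H₂)) = Φ.symm (gprimeTorus L β S c₀) := by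
  obtain ⟨y, hy⟩ := exists_forall_conj_gprimeTorus_eq_archCongr_symm_gprimeTorus L α β S T Φ hΦ hSα hSβ
  apply Subtype.ext
  rw [coe_archStableCentralizerEquiv_eq_of_conj_eq L hdα hd₂ hcorr hreg y (hy c), hz]
  exact hy c₀

include hΦ hSα hSβ in
/-- **… followed by `Φ|_Z`, it is the identity on coordinates**: `Φ|_{Z(γ)} (e z)` has underlying element `gprimeTorus β S c₀` whenever `↑z = gprimeTorus α S c₀` (★ `subgroupCongrHomeomorph`,
★ `forall_archCongr_mem_centralizer_iff`). [cite: Rogawski1990, §4.3 pp. 43–44; §14.1 p. 232] [cite: Shelstad1979, §4 p. 20] -/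
theorem coe_subgroupCongrHomeomorph_archStableCentralizerEquiv_gprimeTorus_of_coe_eq
    (hcorr : Corresponds (conjMixed (↥(maximalRealSubfield L)) L (IsCMField.complexConj L)) (archFormOf L 3 (Matrix.diagonal α)) (archFormOf L 3 H₂)
      (gprimeTorus L α S c) (Φ.symm (gprimeTorus L β S c)))
    (hreg : IsRegularElt ((gprimeTorus L α S c).val : GL (Fin 3) (mixedEmbedding.mixedSpace L)))
    (z : Subgroup.centralizer ({gprimeTorus L α S c} : Set ↥(arch (↥(maximalRealSubfield L)) L (IsCMField.complexConj L) 3 (Matrix.diagonal α))))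
    {c₀ : {w : InfinitePlace L // IsComplex w} → Fin 3 → ℝ}
    (hz : (z : ↥(arch (↥(maximalRealSubfield L)) L (IsCMField.complexConj L) 3 (Matrix.diagonal α))) = gprimeTorus L α S c₀) :
    ((subgroupCongrHomeomorph Φ.toMulEquiv
          (Subgroup.centralizer ({Φ.symm (gprimeTorus L β S c)} : Set ↥(arch (↥(maximalRealSubfield L)) L (IsCMField.complexConj L) 3 H₂)))
          (Subgroup.centralizer ({gprimeTorus L β S c} : Set ↥(arch (↥(maximalRealSubfield L)) L (IsCMField.complexConj L) 3 (Matrix.diagonal β))))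
          (forall_archCongr_mem_centralizer_iff L Φ (Φ.apply_symm_apply (gprimeTorus L β S c))) Φ.continuous Φ.symm.continuous
          (archStableCentralizerEquiv L hdα hd₂ hcorr hreg z) :
        Subgroup.centralizer ({gprimeTorus L β S c} : Set ↥(arch (↥(maximalRealSubfield L)) L (IsCMField.complexConj L) 3 (Matrix.diagonal β)))) :
      ↥(arch (↥(maximalRealSubfield L)) L (IsCMField.complexConj L) 3 (Matrix.diagonal β))) = gprimeTorus L β S c₀ := by
  rw [coe_subgroupCongrHomeomorph_apply]
  show Φ _ = _
  rw [coe_archStableCentralizerEquiv_gprimeTorus_archCongr_symm_of_coe_eq L α β S hdα hd₂ T Φ hΦ hSα hSβ hcorr hreg z hz, ContinuousMulEquiv.apply_symm_apply]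

include hΦ hSα hSβ in
/-- **BOX COHERENCE ACROSS THE TWIST**: through the presentations `T^α_S = Z(γ′)`, `T^β_S = Z(gprimeTorus β S c)`, the composite `Φ|_Z ∘ e` carries the `α`-box `B′_S` onto the `β`-box `B_S`
(both are the images of the SAME coordinate box ★ `chartBox L S`). [cite: Rogawski1990, §4.3 (4.3.1) p. 43; §8.2 p. 122] [cite: Shelstad1979, §4 p. 20; Lemma 4.2 p. 23] -/
theorem image_comp_preimage_chartBoxImgG_eq_preimage_chartBoxImgG
    (hcorr : Corresponds (conjMixed (↥(maximalRealSubfield L)) L (IsCMField.complexConj L)) (archFormOf L 3 (Matrix.diagonal α)) (archFormOf L 3 H₂)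
      (gprimeTorus L α S c) (Φ.symm (gprimeTorus L β S c)))
    (hreg : IsRegularElt ((gprimeTorus L α S c).val : GL (Fin 3) (mixedEmbedding.mixedSpace L)))
    (hTα : chartTorusG L α S = Subgroup.centralizer ({gprimeTorus L α S c} : Set ↥(arch (↥(maximalRealSubfield L)) L (IsCMField.complexConj L) 3 (Matrix.diagonal α))))
    (hTβ : chartTorusG L β S = Subgroup.centralizer ({gprimeTorus L β S c} : Set ↥(arch (↥(maximalRealSubfield L)) L (IsCMField.complexConj L) 3 (Matrix.diagonal β)))) :
    (⇑(subgroupCongrHomeomorph Φ.toMulEquiv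
          (Subgroup.centralizer ({Φ.symm (gprimeTorus L β S c)} : Set ↥(arch (↥(maximalRealSubfield L)) L (IsCMField.complexConj L) 3 H₂)))
          (Subgroup.centralizer ({gprimeTorus L β S c} : Set ↥(arch (↥(maximalRealSubfield L)) L (IsCMField.complexConj L) 3 (Matrix.diagonal β))))
          (forall_archCongr_mem_centralizer_iff L Φ (Φ.apply_symm_apply (gprimeTorus L β S c))) Φ.continuous Φ.symm.continuous) ∘
        ⇑(archStableCentralizerEquiv L hdα hd₂ hcorr hreg)) '' (⇑(MulEquiv.subgroupCongr hTα).symm ⁻¹' chartBoxImgG L α S) =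
      ⇑(MulEquiv.subgroupCongr hTβ).symm ⁻¹' chartBoxImgG L β S := by
  ext z'
  rw [Set.mem_image, mem_preimage_subgroupCongr_symm_chartBoxImgG_iff L β S hTβ]
  constructor
  · rintro ⟨z, hz, rfl⟩
    obtain ⟨c₀, hc₀, hzc⟩ := (mem_preimage_subgroupCongr_symm_chartBoxImgG_iff L α S hTα z).1 hz
    exact ⟨c₀, hc₀, coe_subgroupCongrHomeomorph_archStableCentralizerEquiv_gprimeTorus_of_coe_eq L α β S hdα hd₂ T Φ hΦ hSα hSβ hcorr hreg z hzc⟩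
  · rintro ⟨c₁, hc₁, hz'⟩
    refine ⟨⟨gprimeTorus L α S c₁, hTα ▸ gprimeTorus_mem_chartTorusG L α S c₁⟩,
      (mem_preimage_subgroupCongr_symm_chartBoxImgG_iff L α S hTα _).2 ⟨c₁, hc₁, rfl⟩, ?_⟩
    apply Subtype.ext
    rw [Function.comp_apply, coe_subgroupCongrHomeomorph_archStableCentralizerEquiv_gprimeTorus_of_coe_eq L α β S hdα hd₂ T Φ hΦ hSα hSβ hcorr hreg _ rfl, hz']

end Transport

/-! ## §3 The two junction scalars coincide: the `G′`-frame mass at `γ′` equals the pushed `G`-frame mass at the partner chart point -/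

section Scalars

variable (L : Type) [Field L] [NumberField L] [IsCMField L] (α β : Fin 3 → L) (S : Finset {w : InfinitePlace L // IsComplex w})
  {H₂ : Matrix (Fin 3) (Fin 3) L}
  [MeasurableSpace ↥(arch (↥(maximalRealSubfield L)) L (IsCMField.complexConj L) 3 (Matrix.diagonal α))] [BorelSpace ↥(arch (↥(maximalRealSubfield L)) L (IsCMField.complexConj L) 3 (Matrix.diagonal α))]
  [MeasurableSpace ↥(arch (↥(maximalRealSubfield L)) L (IsCMField.complexConj L) 3 (Matrix.diagonal β))] [BorelSpace ↥(arch (↥(maximalRealSubfield L)) L (IsCMField.complexConj L) 3 (Matrix.diagonal β))]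
  [MeasurableSpace ↥(arch (↥(maximalRealSubfield L)) L (IsCMField.complexConj L) 3 H₂)] [BorelSpace ↥(arch (↥(maximalRealSubfield L)) L (IsCMField.complexConj L) 3 H₂)]
  (t' : ∀ γ' : ↥(arch (↥(maximalRealSubfield L)) L (IsCMField.complexConj L) 3 (Matrix.diagonal α)), Measure (Subgroup.centralizer ({γ'} : Set ↥(arch (↥(maximalRealSubfield L)) L (IsCMField.complexConj L) 3 (Matrix.diagonal α)))))
  (t : ∀ γ : ↥(arch (↥(maximalRealSubfield L)) L (IsCMField.complexConj L) 3 H₂), Measure (Subgroup.centralizer ({γ} : Set ↥(arch (↥(maximalRealSubfield L)) L (IsCMField.complexConj L) 3 H₂))))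
  (tβ : ∀ δ : ↥(arch (↥(maximalRealSubfield L)) L (IsCMField.complexConj L) 3 (Matrix.diagonal β)), Measure (Subgroup.centralizer ({δ} : Set ↥(arch (↥(maximalRealSubfield L)) L (IsCMField.complexConj L) 3 (Matrix.diagonal β)))))
  (hdα : (Matrix.diagonal α).det ≠ 0) (hd₂ : H₂.det ≠ 0)
  (T : GL (Fin 3) (mixedEmbedding.mixedSpace L))
  (Φ : arch (↥(maximalRealSubfield L)) L (IsCMField.complexConj L) 3 H₂ ≃ₜ* arch (↥(maximalRealSubfield L)) L (IsCMField.complexConj L) 3 (Matrix.diagonal β))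
  (hΦ : ∀ g : arch (↥(maximalRealSubfield L)) L (IsCMField.complexConj L) 3 H₂,
    ((Φ g : arch (↥(maximalRealSubfield L)) L (IsCMField.complexConj L) 3 (Matrix.diagonal β)) : GL (Fin 3) (mixedEmbedding.mixedSpace L)) =
      T * (g : GL (Fin 3) (mixedEmbedding.mixedSpace L)) * T⁻¹)
  -- (C′G) of ★ `ArchCompatibleFamiliesG`, shape VERBATIM with `H₂` for the literal `Φ₃`
  (hC'G : ∀ (γ' : ↥(arch (↥(maximalRealSubfield L)) L (IsCMField.complexConj L) 3 (Matrix.diagonal α))) (γ : ↥(arch (↥(maximalRealSubfield L)) L (IsCMField.complexConj L) 3 H₂))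
      (h' : IsRegularElt (γ'.val : GL (Fin 3) (mixedEmbedding.mixedSpace L)))
      (hc : Corresponds (UnitaryGroup.conjMixed (↥(maximalRealSubfield L)) L (IsCMField.complexConj L))
        (UnitaryGroup.archFormOf L 3 (Matrix.diagonal α)) (UnitaryGroup.archFormOf L 3 H₂) γ' γ),
      Measure.map ⇑(UnitaryGroup.archStableCentralizerEquiv L hdα hd₂ hc h') (t' γ') = t γ)
  -- the torus datum on `U(diag β)` PUSHED from `t` along `Φ` (the `ht` shape of ★ `ArchWeilDataCongruence`)
  (htβ : ∀ δ, tβ δ = Measure.map (subgroupCongrHomeomorph Φ.toMulEquiv (Subgroup.centralizer ({Φ.symm δ} : Set _)) (Subgroup.centralizer ({δ} : Set _))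
    (forall_archCongr_mem_centralizer_iff L Φ (Φ.apply_symm_apply δ)) Φ.continuous Φ.symm.continuous) (t (Φ.symm δ)))
  (hSα : ∀ w ∈ S, w ∈ splitChartPlaces L α) (hSβ : ∀ w ∈ S, w ∈ splitChartPlaces L β)
  {c : {w : InfinitePlace L // IsComplex w} → Fin 3 → ℝ} (hc : c ∈ ArchCartan.RegG S)

include hΦ hC'G htβ hSα hSβ hc in
/-- **THE `G′`- AND `G`-BOX MASSES AGREE AT PARTNERS (Shelstad's normalisation in (C′G) currency), in measure form**: in one frame with (C′G) across the twist and the pushed torus datum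
`t_β` on `U(diag β)(L⁺ ⊗ ℝ)`, for `c ∈ RegG S` the torus measures `t′(gprimeTorus α S c)` and `t_β(gprimeTorus β S c)`, read on the boxes of the chart tori `T^α_S`, `T^β_S` through the two
presentations, give the boxes THE SAME MASS (`t_β(γ_β) = (Φ|_Z ∘ e)_* t′(γ′)`; §2; injectivity). [cite: Rogawski1990, §1.7 p. 6; §4.3 (4.3.1) pp. 43–44; §14.1 p. 232] [cite: Shelstad1979, §4 p. 20]
[cite: LanglandsShelstad1987, §1.3–1.4] -/
theorem map_t'_chartBoxImgG_eq_map_torusPush_chartBoxImgG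
    (hTα : chartTorusG L α S = Subgroup.centralizer ({gprimeTorus L α S c} : Set ↥(arch (↥(maximalRealSubfield L)) L (IsCMField.complexConj L) 3 (Matrix.diagonal α))))
    (hTβ : chartTorusG L β S = Subgroup.centralizer ({gprimeTorus L β S c} : Set ↥(arch (↥(maximalRealSubfield L)) L (IsCMField.complexConj L) 3 (Matrix.diagonal β)))) :
    (t' (gprimeTorus L α S c)).map ⇑(MulEquiv.subgroupCongr hTα).symm (chartBoxImgG L α S) =
      (tβ (gprimeTorus L β S c)).map ⇑(MulEquiv.subgroupCongr hTβ).symm (chartBoxImgG L β S) := by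
  have hreg : IsRegularElt ((gprimeTorus L α S c).val : GL (Fin 3) (mixedEmbedding.mixedSpace L)) := (isRegularElt_gprimeTorus_iff_mem_regG L α S c hSα).2 hc
  have hcorr : Corresponds (conjMixed (↥(maximalRealSubfield L)) L (IsCMField.complexConj L)) (archFormOf L 3 (Matrix.diagonal α)) (archFormOf L 3 H₂)
      (gprimeTorus L α S c) (Φ.symm (gprimeTorus L β S c)) :=
    corresponds_gprimeTorus_archCongr_symm_gprimeTorus' L α β S T Φ hΦ hSα hSβ c
  -- the two readings as pre-image masses
  have hmα : Measurable ⇑(MulEquiv.subgroupCongr hTα).symm := (continuous_subtype_val.subtype_mk _ : Continuous ⇑(MulEquiv.subgroupCongr hTα).symm).measurable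
  have hmβ : Measurable ⇑(MulEquiv.subgroupCongr hTβ).symm := (continuous_subtype_val.subtype_mk _ : Continuous ⇑(MulEquiv.subgroupCongr hTβ).symm).measurable
  have hBα : MeasurableSet (chartBoxImgG L α S) := (isCompact_chartBoxImgG L α S).isClosed.measurableSet
  have hBβ : MeasurableSet (chartBoxImgG L β S) := (isCompact_chartBoxImgG L β S).isClosed.measurableSet
  -- `t_β(γ_β) = (Φ|_Z)_* (e_* t′(γ′))`, read on the pre-image boxes
  have hmF : Measurable ⇑(subgroupCongrHomeomorph Φ.toMulEquiv
      (Subgroup.centralizer ({Φ.symm (gprimeTorus L β S c)} : Set ↥(arch (↥(maximalRealSubfield L)) L (IsCMField.complexConj L) 3 H₂)))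
      (Subgroup.centralizer ({gprimeTorus L β S c} : Set ↥(arch (↥(maximalRealSubfield L)) L (IsCMField.complexConj L) 3 (Matrix.diagonal β))))
      (forall_archCongr_mem_centralizer_iff L Φ (Φ.apply_symm_apply (gprimeTorus L β S c))) Φ.continuous Φ.symm.continuous) :=
    (subgroupCongrHomeomorph Φ.toMulEquiv _ _ (forall_archCongr_mem_centralizer_iff L Φ (Φ.apply_symm_apply (gprimeTorus L β S c))) Φ.continuous Φ.symm.continuous).continuous.measurable
  have hme : Measurable ⇑(archStableCentralizerEquiv L hdα hd₂ hcorr hreg) := (archStableCentralizerEquiv L hdα hd₂ hcorr hreg).continuous.measurable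
  have hinj : Function.Injective (⇑(subgroupCongrHomeomorph Φ.toMulEquiv
      (Subgroup.centralizer ({Φ.symm (gprimeTorus L β S c)} : Set ↥(arch (↥(maximalRealSubfield L)) L (IsCMField.complexConj L) 3 H₂)))
      (Subgroup.centralizer ({gprimeTorus L β S c} : Set ↥(arch (↥(maximalRealSubfield L)) L (IsCMField.complexConj L) 3 (Matrix.diagonal β))))
      (forall_archCongr_mem_centralizer_iff L Φ (Φ.apply_symm_apply (gprimeTorus L β S c))) Φ.continuous Φ.symm.continuous) ∘
        ⇑(archStableCentralizerEquiv L hdα hd₂ hcorr hreg)) :=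
    (Homeomorph.injective _).comp (archStableCentralizerEquiv L hdα hd₂ hcorr hreg).injective
  rw [Measure.map_apply hmα hBα, Measure.map_apply hmβ hBβ, htβ, Measure.map_apply hmF (hmβ hBβ), ← hC'G _ _ hreg hcorr, Measure.map_apply hme (hmF (hmβ hBβ)),
    ← Set.preimage_comp, ← image_comp_preimage_chartBoxImgG_eq_preimage_chartBoxImgG L α β S hdα hd₂ T Φ hΦ hSα hSβ hcorr hreg hTα hTβ, hinj.preimage_image]

include hΦ hC'G htβ hSα hSβ hc in
/-- **THE TWO JUNCTION SCALARS COINCIDE**: `M′_{t′}(gprimeTorus α S c) = M_{t_β}(gprimeTorus β S c)` — the `M′(c)` of ★ READ-G′ `stableOrbitalIntegralRel_gprimeTorus_mul_boxMass_eq_sum` at the frame `α`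
equals its `M′(c)` at the frame `β` on the pushed torus datum; so at partner chart points the two stable orbital integrals `Φ^st_{m′}(γ′, a′)`, `Φ^st_m(γ, a)` (the latter read on the `β`-atlas by
★ `archStableOrbitalIntegral_transport_archCongr`) agree iff the two slot sums of `chartOrbG` agree. [cite: Rogawski1990, §4.3 (4.3.1) pp. 43–44; §14.2 (14.2.1) p. 232] [cite: Shelstad1979, §4 p. 20] -/
theorem toReal_map_t'_chartBoxImgG_eq_toReal_map_torusPush_chartBoxImgG
    (hTα : chartTorusG L α S = Subgroup.centralizer ({gprimeTorus L α S c} : Set ↥(arch (↥(maximalRealSubfield L)) L (IsCMField.complexConj L) 3 (Matrix.diagonal α))))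
    (hTβ : chartTorusG L β S = Subgroup.centralizer ({gprimeTorus L β S c} : Set ↥(arch (↥(maximalRealSubfield L)) L (IsCMField.complexConj L) 3 (Matrix.diagonal β)))) :
    ((t' (gprimeTorus L α S c)).map ⇑(MulEquiv.subgroupCongr hTα).symm (chartBoxImgG L α S)).toReal =
      ((tβ (gprimeTorus L β S c)).map ⇑(MulEquiv.subgroupCongr hTβ).symm (chartBoxImgG L β S)).toReal := by
  rw [map_t'_chartBoxImgG_eq_map_torusPush_chartBoxImgG L α β S t' t tβ hdα hd₂ T Φ hΦ hC'G htβ hSα hSβ hc hTα hTβ]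

end Scalars

/-! ## §4 The quasi-split instance `β₀ = (½, 1, −½)`: every complex place is a split-chart place -/

section QuasiSplit

variable (L : Type) [Field L] [NumberField L] [IsCMField L] (α : Fin 3 → L) (S : Finset {w : InfinitePlace L // IsComplex w})
  {H₂ : Matrix (Fin 3) (Fin 3) L}
  [MeasurableSpace ↥(arch (↥(maximalRealSubfield L)) L (IsCMField.complexConj L) 3 (Matrix.diagonal α))] [BorelSpace ↥(arch (↥(maximalRealSubfield L)) L (IsCMField.complexConj L) 3 (Matrix.diagonal α))]
  [MeasurableSpace ↥(arch (↥(maximalRealSubfield L)) L (IsCMField.complexConj L) 3 (Matrix.diagonal ![(2 : L)⁻¹, 1, -(2 : L)⁻¹]))]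
  [BorelSpace ↥(arch (↥(maximalRealSubfield L)) L (IsCMField.complexConj L) 3 (Matrix.diagonal ![(2 : L)⁻¹, 1, -(2 : L)⁻¹]))]
  [MeasurableSpace ↥(arch (↥(maximalRealSubfield L)) L (IsCMField.complexConj L) 3 H₂)] [BorelSpace ↥(arch (↥(maximalRealSubfield L)) L (IsCMField.complexConj L) 3 H₂)]
  (t' : ∀ γ' : ↥(arch (↥(maximalRealSubfield L)) L (IsCMField.complexConj L) 3 (Matrix.diagonal α)), Measure (Subgroup.centralizer ({γ'} : Set ↥(arch (↥(maximalRealSubfield L)) L (IsCMField.complexConj L) 3 (Matrix.diagonal α)))))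
  (t : ∀ γ : ↥(arch (↥(maximalRealSubfield L)) L (IsCMField.complexConj L) 3 H₂), Measure (Subgroup.centralizer ({γ} : Set ↥(arch (↥(maximalRealSubfield L)) L (IsCMField.complexConj L) 3 H₂))))
  (tβ : ∀ δ : ↥(arch (↥(maximalRealSubfield L)) L (IsCMField.complexConj L) 3 (Matrix.diagonal ![(2 : L)⁻¹, 1, -(2 : L)⁻¹])),
    Measure (Subgroup.centralizer ({δ} : Set ↥(arch (↥(maximalRealSubfield L)) L (IsCMField.complexConj L) 3 (Matrix.diagonal ![(2 : L)⁻¹, 1, -(2 : L)⁻¹])))))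
  (hdα : (Matrix.diagonal α).det ≠ 0) (hd₂ : H₂.det ≠ 0)
  (T : GL (Fin 3) (mixedEmbedding.mixedSpace L))
  (Φ : arch (↥(maximalRealSubfield L)) L (IsCMField.complexConj L) 3 H₂ ≃ₜ* arch (↥(maximalRealSubfield L)) L (IsCMField.complexConj L) 3 (Matrix.diagonal ![(2 : L)⁻¹, 1, -(2 : L)⁻¹]))
  (hΦ : ∀ g : arch (↥(maximalRealSubfield L)) L (IsCMField.complexConj L) 3 H₂,
    ((Φ g : arch (↥(maximalRealSubfield L)) L (IsCMField.complexConj L) 3 (Matrix.diagonal ![(2 : L)⁻¹, 1, -(2 : L)⁻¹])) : GL (Fin 3) (mixedEmbedding.mixedSpace L)) =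
      T * (g : GL (Fin 3) (mixedEmbedding.mixedSpace L)) * T⁻¹)
  (hC'G : ∀ (γ' : ↥(arch (↥(maximalRealSubfield L)) L (IsCMField.complexConj L) 3 (Matrix.diagonal α))) (γ : ↥(arch (↥(maximalRealSubfield L)) L (IsCMField.complexConj L) 3 H₂))
      (h' : IsRegularElt (γ'.val : GL (Fin 3) (mixedEmbedding.mixedSpace L)))
      (hc : Corresponds (UnitaryGroup.conjMixed (↥(maximalRealSubfield L)) L (IsCMField.complexConj L))
        (UnitaryGroup.archFormOf L 3 (Matrix.diagonal α)) (UnitaryGroup.archFormOf L 3 H₂) γ' γ),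
      Measure.map ⇑(UnitaryGroup.archStableCentralizerEquiv L hdα hd₂ hc h') (t' γ') = t γ)
  (htβ : ∀ δ, tβ δ = Measure.map (subgroupCongrHomeomorph Φ.toMulEquiv (Subgroup.centralizer ({Φ.symm δ} : Set _)) (Subgroup.centralizer ({δ} : Set _))
    (forall_archCongr_mem_centralizer_iff L Φ (Φ.apply_symm_apply δ)) Φ.continuous Φ.symm.continuous) (t (Φ.symm δ)))
  (hSα : ∀ w ∈ S, w ∈ splitChartPlaces L α) {c : {w : InfinitePlace L // IsComplex w} → Fin 3 → ℝ} (hc : c ∈ ArchCartan.RegG S)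

include hΦ hC'G htβ hSα hc in
/-- **THE JUNCTION SCALARS COINCIDE, QUASI-SPLIT INSTANCE**: with the `G`-atlas at `β₀ = (½, 1, −½)` (★ `formCongr_quasiSplitFrame_diagonal`: `U(H₂) = U(Φ₃) ≅ U(diag β₀)`) the chart set only has to be
admissible for `α` (★ `mem_splitChartPlaces_quasiSplitWeights`): `M′_{t′}(gprimeTorus α S c) = M_{t_{β₀}}(gprimeTorus β₀ S c)` for every `c ∈ RegG S`. [cite: Rogawski1990, §14.1 p. 232; §14.2 (14.2.1) p. 232;
§4.3 (4.3.1) pp. 43–44] [cite: Shelstad1979, §4 p. 20] -/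
theorem toReal_map_t'_chartBoxImgG_eq_toReal_map_torusPush_chartBoxImgG_quasiSplit
    (hTα : chartTorusG L α S = Subgroup.centralizer ({gprimeTorus L α S c} : Set ↥(arch (↥(maximalRealSubfield L)) L (IsCMField.complexConj L) 3 (Matrix.diagonal α))))
    (hTβ : chartTorusG L ![(2 : L)⁻¹, 1, -(2 : L)⁻¹] S =
      Subgroup.centralizer ({gprimeTorus L ![(2 : L)⁻¹, 1, -(2 : L)⁻¹] S c} : Set ↥(arch (↥(maximalRealSubfield L)) L (IsCMField.complexConj L) 3 (Matrix.diagonal ![(2 : L)⁻¹, 1, -(2 : L)⁻¹])))) :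
    ((t' (gprimeTorus L α S c)).map ⇑(MulEquiv.subgroupCongr hTα).symm (chartBoxImgG L α S)).toReal =
      ((tβ (gprimeTorus L ![(2 : L)⁻¹, 1, -(2 : L)⁻¹] S c)).map ⇑(MulEquiv.subgroupCongr hTβ).symm (chartBoxImgG L ![(2 : L)⁻¹, 1, -(2 : L)⁻¹] S)).toReal :=
  toReal_map_t'_chartBoxImgG_eq_toReal_map_torusPush_chartBoxImgG L α _ S t' t tβ hdα hd₂ T Φ hΦ hC'G htβ hSα (fun w _ => mem_splitChartPlaces_quasiSplitWeights L w) hc hTα hTβ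

end QuasiSplit

end Literature.NumberTheory.Rogawski1990

end
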